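import Summits.QuantumFields.BalabanUV.T4Continuum.Support.GradedWellData
import Summits.QuantumFields.BalabanUV.T4Continuum.Support.RegionLocalComponentwise

/-!
# T⁴ programme, spine node NE2 (U1a), sub-row Δ1 «NE2⁰-Dirichlet» — THE GRADED-WELL LOCAL OPERATOR IS COMPONENTWISE:
# `localGW = ⊕_ν (localGW)_ν` on the torus and its resolvent commutes with the direction projections, so (GW-L) is `d` copies of a
# SCALAR torus two-level law with graded block masses

NE2 formalisation swarm `b2b-balaban-t4-ne2-formalise-*`, LEAF PROVER 07 (gen 11), file 3 of the supplier brick «Δ1-LOC-COMPONENTWISE» (file 1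
`Support/RegionLocalComponentwise` §1: generic direction splitting), on the row owner's O16-b `Support/GradedWellData` (R47 model of record, journal
2026-08-21 l.25022 / l.25177: «your direction-splitting transfers verbatim to `localGW` via `localGW_eq` — `LapV` and the `avgS` Gram have no
cross-direction entries»).  Exactly that, in the kernel:

 * the torus translation `shiftM`, the forward difference `fdiff`, hence the vector Laplacian `LapV = Σ_ν fdiffᴴ·fdiff`, have no cross-direction
   entries (`LapV_apply_eq_zero_of_ne` — the componentwise Laplacian);
 * the graded vector averaging `QvGW` reads, in its row `(i, (z, μ))`, only bonds of direction `μ` (`avgS`'s `if i.2 = b.2`), so its Gram matrix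
   has no cross-direction entries;
 * **`localGW_apply_eq_zero_of_ne : b.2 ≠ b′.2 → localGW b b′ = 0`** (by `localGW_eq`), `localGW_mul_compP`, `form_localGW_eq_sum`, and
   **`localGW_inv_mul_compP (hU : IsUnit localGW.det) : localGW⁻¹ * compP ν = compP ν * localGW⁻¹`** — component `ν` of `localGW⁻¹ f` depends
   on `f_ν` only, at every level, for every layer map.

HONEST FRAMING (T4-DAG p. 1).  Model level (`U = 1`, one layer map on unit blocks, `m` fixed, finite torus); [folklore] algebra over landed
modules; no estimate, no rate, nothing printed asserted; the FAITHFUL `regionGW` is NOT componentwise (its gauge sandwich couples directions);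
NE2 (U1a) NOT proved; spine PROVED 0/9 unchanged; NOT [B9] (3.16)/(3.23)–(3.27)/(3.42) as printed; NOT infinite volume / mass gap / Clay.  HONEST
DEPENDENCY: continuum YM on T⁴ ⇐ BetaPertH ∧ nine spine estimates (0/9 proved); BetaPertH ⇐ (D1) ∧ (D4) ∧ CAP+tail; G-an2-4 gates asym, D1 and
NE2/3/4.  No `sorry`.
-/

noncomputable section

open scoped BigOperators ComplexConjugate Matrix
open Finset

namespace Summit.QuantumFields.BalabanUV.T4Continuum.GradedWellComponentwise

open Literature.MathematicalPhysics.QuantumFieldTheory.Balaban1983to89.B5Prop11Plancherel (Tor fine unitVec shiftM fdiff)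
open Literature.MathematicalPhysics.QuantumFieldTheory.Balaban1983to89.B5Action121 (LapV)
open Literature.MathematicalPhysics.QuantumFieldTheory.Balaban1983to89.B5G183RateUnitTower (lev lev_neZero)
open Summit.QuantumFields.BalabanUV.T4Continuum
open Summit.QuantumFields.BalabanUV.T4Continuum.GradedSubBlocks (avgS)
open Summit.QuantumFields.BalabanUV.T4Continuum.GradedWellData (TorK RowV QvGW localGW localGW_eq)
open Summit.QuantumFields.BalabanUV.T4Continuum.RegionLocalComponentwise (compP gram_apply_eq_zero_of_dir mul_compP_eq_of_apply_eq_zero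
  form_eq_sum_compP inv_mul_compP_of_apply_eq_zero add_apply_eq_zero_of_apply_eq_zero smul_apply_eq_zero_of_apply_eq_zero)

variable {d : ℕ}

/-! ## §1 Torus building blocks preserve the direction -/

section TorusOps

variable (N : Fin d → ℕ) [∀ ν, NeZero (N ν)]

omit [∀ ν, NeZero (N ν)] in
/-- the translation `shiftM ν` keeps the component. [folklore] -/
theorem shiftM_apply_eq_zero_of_ne (ν : Fin d) {i j : Tor N × Fin d} (h : i.2 ≠ j.2) : shiftM N ν i j = 0 := by
  unfold shiftM
  rw [if_neg]
  intro hj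
  apply h
  rw [hj]

omit [∀ ν, NeZero (N ν)] in
/-- the forward difference `fdiff ν` keeps the component. [folklore] -/
theorem fdiff_apply_eq_zero_of_ne (c : ℂ) (ν : Fin d) {i j : Tor N × Fin d} (h : i.2 ≠ j.2) : fdiff N c ν i j = 0 := by
  have hne : i ≠ j := fun e => h (congrArg Prod.snd e)
  unfold fdiff
  rw [Matrix.smul_apply, Matrix.sub_apply, shiftM_apply_eq_zero_of_ne N ν h, Matrix.one_apply_ne hne, sub_zero, smul_zero]

/-- **THE VECTOR LAPLACIAN `LapV` IS COMPONENTWISE** (no cross-direction entries). [folklore] -/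
theorem LapV_apply_eq_zero_of_ne (c : ℂ) {i j : Tor N × Fin d} (h : i.2 ≠ j.2) : LapV N c i j = 0 := by
  unfold LapV
  rw [Matrix.sum_apply]
  exact Finset.sum_eq_zero fun ν _ =>
    gram_apply_eq_zero_of_dir Prod.snd (fdiff N c ν) Prod.snd (fun _ _ hab => fdiff_apply_eq_zero_of_ne N c ν hab) h

end TorusOps

/-! ## §2 The graded well -/

section GW

variable (L : ℕ) [NeZero L] (M : Fin d → ℕ) [hM : ∀ μ, NeZero (M μ)] (k m : ℕ) (layer : Tor M → ℕ) (a : ℝ)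

/-- a row `(i, (z, μ))` of the graded vector averaging reads only bonds of direction `μ`. [folklore] -/
theorem QvGW_apply_eq_zero_of_ne {p : RowV L M k m layer} {b : TorK L M k × Fin d} (h : p.1.2.2 ≠ b.2) :
    QvGW L M k m layer p b = 0 := by
  unfold QvGW avgS
  rw [if_neg (fun e => h e.symm), mul_zero]

/-- the Gram matrix of the graded vector averaging has no cross-direction entries. [folklore] -/
theorem QvGW_gram_apply_eq_zero_of_ne {b b' : TorK L M k × Fin d} (h : b.2 ≠ b'.2) :
    ((QvGW L M k m layer)ᴴ * QvGW L M k m layer) b b' = 0 :=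
  gram_apply_eq_zero_of_dir Prod.snd (QvGW L M k m layer) (fun p => p.1.2.2) (fun _ _ hp => QvGW_apply_eq_zero_of_ne L M k m layer hp) h

/-- **`localGW` HAS NO CROSS-DIRECTION ENTRIES** (`localGW = LapV + a·QvGWᴴQvGW`, both summands componentwise). [folklore] -/
theorem localGW_apply_eq_zero_of_ne {b b' : TorK L M k × Fin d} (h : b.2 ≠ b'.2) : localGW L M k m layer a b b' = 0 := by
  rw [localGW_eq]
  exact add_apply_eq_zero_of_apply_eq_zero Prod.snd (fun _ _ h' => LapV_apply_eq_zero_of_ne _ _ h')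
    (fun _ _ h' => smul_apply_eq_zero_of_apply_eq_zero Prod.snd _ (fun _ _ h'' => QvGW_gram_apply_eq_zero_of_ne L M k m layer h'') h') h

/-- `localGW` commutes with the direction projections. [folklore] -/
theorem localGW_mul_compP (ν : Fin d) :
    localGW L M k m layer a * compP Prod.snd ν = compP Prod.snd ν * localGW L M k m layer a :=
  mul_compP_eq_of_apply_eq_zero Prod.snd (fun _ _ h => localGW_apply_eq_zero_of_ne L M k m layer a h) ν

/-- the form of `localGW` splits direction by direction: `⟨A, localGW A⟩ = Σ_ν ⟨A_ν, localGW A_ν⟩`. [folklore] -/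
theorem form_localGW_eq_sum (A : TorK L M k × Fin d → ℂ) :
    star A ⬝ᵥ (localGW L M k m layer a *ᵥ A)
      = ∑ ν, star (compP Prod.snd ν *ᵥ A) ⬝ᵥ (localGW L M k m layer a *ᵥ (compP Prod.snd ν *ᵥ A)) :=
  form_eq_sum_compP Prod.snd (fun _ _ h => localGW_apply_eq_zero_of_ne L M k m layer a h) A

/-- **THE GRADED-WELL LOCAL RESOLVENT IS COMPONENTWISE**: `localGW⁻¹ * compP ν = compP ν * localGW⁻¹` whenever `localGW` is invertible
(e.g. by `GradedWellData.coercive_localGW_of`). [folklore] -/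
theorem localGW_inv_mul_compP (hU : IsUnit (localGW L M k m layer a).det) (ν : Fin d) :
    (localGW L M k m layer a)⁻¹ * compP Prod.snd ν = compP Prod.snd ν * (localGW L M k m layer a)⁻¹ :=
  inv_mul_compP_of_apply_eq_zero Prod.snd (fun _ _ h => localGW_apply_eq_zero_of_ne L M k m layer a h) hU ν

end GW

end Summit.QuantumFields.BalabanUV.T4Continuum.GradedWellComponentwise

end
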